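import Summits.HodgeConjecture.HodgeConjecture.Theorems.R90S2ArchLocalCuspidalDefs     -- ★ p863651 S2-R13 Defs: `cptToComplex`, `IsArchFactoredAt` (compact-place frame); brings ★ `arch`, `archLocal`, `archPiEquivCM`, `C_c`
import HarnessLib

/-!
# R90-TF ∕ S2 «Ch. 12 archimedean block» — CARD 2 (L-⊠, construction half) `R90S2ArchPureTensor`: PURE TENSORS of archimedean test functions

Cell `pub/hodgecm-mathlib`, HCML Track R90-TF, section S2 (base `R90-C11`); crux h413 = `stmt-HodgeConjecture-24833`, route of record `HCCMUnconditional`.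
Hand: prover seat hodgecm-mathlib-K2E3-p25 (g5) (E3 hand routed to S2 by the chair's ACROSS-LINES VALVE 2026-09-05T01:35:46Z); dealer K2E1b-plan (g8), HEADS
`K2/K2E1b-plan/g8/HEADS-CARD2-R90S2ArchPureTensor.v1.K2E1b-plan-g8.md` (4129af9983b6ee32); road memo `PAYMENT-ROADS-S2.v1` §2 (2).  THEOREMS with real proofs + three
small `def`s (`archTensor`, `archTensorAway`, and the two-factor twins `archTensor₂`, `archTensorAway₂`); NO socket, NO instance, NO notation, NO `sorry`, default heartbeats.
E1-grade: Mathlib + ★ `UnitaryGroupArchimedeanPlaces` only — NO printed input, NO dependence on the (unfiled) FILE 1 `R90S2ArchCuspPinDefs`.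

## WHAT IS PROVED

Along the ★ factorisation `archPiEquivCM L H : U(H)(L ⊗ ℝ) ≃ₜ* ∏_w U(σ_w H)(ℂ)` (product over the complex places `w` of the CM field `L` — all of them), a family of
local test functions `φ_w ∈ C_c(U(σ_w H)(ℂ), ℂ)` has a PURE TENSOR `⊗_w φ_w ∈ C_c(U(H)(L ⊗ ℝ), ℂ)`, `g ↦ ∏_w φ_w(g_w)`:

* §1 (G-side, any `N`, `H`) `archTensor L H φ` — continuity (finite product of continuous maps) and COMPACT SUPPORT (the support lies in the pull-back of the compact box
  `∏_w tsupport φ_w` along the homeomorphism `archPiEquivCM`); `archTensor_apply` (`rfl`); the away-from-`w` factor `archTensorAway L H φ w : (∏_{w' ≠ w} U(σ_{w'} H)(ℂ)) → ℂ`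
  with its continuity and compact support; **`archTensor_factorsAt`**: `⊗ φ = φ_w ⊗ (⊗_{w' ≠ w} φ_{w'})` AT EVERY complex place `w`, stated in RAW form — its statement IS the body
  of FILE 1's `IsArchFactoredAtPlace H w ⇑(archTensor L H φ) ⇑(φ w) (archTensorAway L H φ w)` (dealer probe 89656e40 P1), so the FILE-1-currency corollary is a definitional
  one-liner filed later; the ★ compact-place frame `isArchFactoredAt_archTensor` (★ `R90.S2.IsArchFactoredAt ι H τ`, `τ : CptPlace L ι`) is given here by name;
  one-place surgery: `archTensorAway_update_self`, `archTensor_update_factorsAt`, and **`archTensor_update_sub`** — print's «`f = (f_{1u} − f_{2u}) ⊗ ⊗_{w ≠ u} f_w`»: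
  the difference of two pure tensors that differ at ONE place is the pure tensor of the difference.
* §2 (two-factor side, GENERIC in `(N₁, H₁) × (N₂, H₂)`, dealer «=» 01:48:02Z) the same five items for
  `archTensor₂ L H₁ H₂ φ₂ : C_c(U(H₁)(L ⊗ ℝ) × U(H₂)(L ⊗ ℝ), ℂ)`, `g ↦ ∏_w φ₂,w (g.1_w, g.2_w)`, with the away factor on the PAIR of away-tuples (FILE 1's
  `IsArchFactoredAtPlace₂` frame, probe P1-H :101–:106): `archTensor₂_factorsAt`, `archTensor₂_update_sub`.  CARRIER READ-BACKS (certified in the hand's scratch over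
  ★ `R90S10ArchSignKitDefs`, farm rc 0, NOT imported here to keep the closure light — that module is needed for nothing else):
  `example (φ₂ : ∀ w, C_c(↥(archLocal L 2 Φ₂ w) × ↥(archLocal L 1 Φ₁ w), ℂ)) : C_c(HInf L, ℂ) := archTensor₂ L Φ₂ Φ₁ φ₂` and
  `example (φ : ∀ w, C_c(↥(archLocal L 3 (phi3 L) w), ℂ)) : C_c(GInf L, ℂ) := archTensor L (phi3 L) φ` elaborate by `rfl` (`Φ₂`, `Φ₁` the
  `Matrix.of fun i j : Fin 2 => if i.val + j.val + 1 = 2 then (1 : L) else 0` ∕ `Fin 1` literals of ★ `HInf`), so S10 ∕ T2 consumers use these at `HInf L`, `GInf L` with no adapter.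

NOT HERE (honest, HEADS §3): `ArchSmooth L N H ⇑(archTensor L H φ)` from place-wise smoothness (★ `ArchSmooth` is restriction of a right-translation-smooth function on
`GL_N(L ⊗ ℝ)`; needs the smooth dictionary `GL_N(L ⊗ ℝ) ↔ ∏_w GL_N(ℂ)` — a named hypothesis of the T2 assembly), and traces of tensor-product representations (letter ℓ3).

HONEST LABEL: construction lemmas (pure tensors exist as `C_c` functions, factor at every place, one-place differences stay pure — what T2 (g)'s `∃ fτ fc` consumes);
no printed input is paid; HC_CM is proved only modulo the 7 printed citations (2 remaining named inputs: hLiu418 = `stmt-HodgeConjecture-24832`, h413 =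
`stmt-HodgeConjecture-24833`) until rung 0 closes.  Count-neutral helper (`--supports stmt-HodgeConjecture-24833 --as helper`).

References: [Rogawski1990] §13.8 p. 218 (proof of Prop. 13.8.3, lines 20–28: `f = ⊗ f_w`, `f_{1u} − f_{2u}` at one place), §14.2 p. 232; [BorelJacquet1979] §4.1
(local components of a factorizable function); [Arthur1988InvariantTraceFormulaII] §7.
-/

set_option autoImplicit false
set_option linter.dupNamespace false

noncomputable section

open NumberField NumberField.InfinitePlace CompactlySupported Topology
open scoped Matrix MatrixGroups Classical
open Literature.NumberTheory.Automorphic Literature.NumberTheory.Automorphic.UnitaryGroup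

namespace Summit.HodgeConjecture.HodgeConjecture.R90.S2

variable (L : Type) [Field L] [NumberField L] [IsCMField L]

/-! ## §1 G-side pure tensors on `U(H)(L ⊗ ℝ)`, any `N`, `H` -/

section GSide

variable {N : ℕ} (H : Matrix (Fin N) (Fin N) L)

/-- **PURE TENSOR `⊗_w φ_w` of local archimedean test functions**: `g ↦ ∏_w φ_w (g_w)` along ★ `archPiEquivCM : U(H)(L ⊗ ℝ) ≃ₜ* ∏_w U(σ_w H)(ℂ)`, a continuous
compactly supported function on `U(H)(L ⊗ ℝ)` (support inside the pull-back of the compact box `∏_w tsupport φ_w` along the homeomorphism) — the factorizable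
archimedean test functions `f_∞ = ⊗_v f_v`. [cite: BorelJacquet1979, §4.1] [cite: Rogawski1990, §13.8 p. 218 L20–28] -/
def archTensor (φ : ∀ w : {w : InfinitePlace L // w.IsComplex}, C_c(↥(archLocal L N H w), ℂ)) :
    C_c(↥(arch (↥(maximalRealSubfield L)) L (IsCMField.complexConj L) N H), ℂ) where
  toFun g := ∏ w, φ w (archPiEquivCM L H (N := N) g w)
  continuous_toFun :=
    continuous_finsetProd _ fun w _ => (φ w).continuous.comp ((continuous_apply w).comp (archPiEquivCM L H (N := N)).continuous)
  hasCompactSupport' := by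
    refine HasCompactSupport.intro'
      (K := ⇑(archPiEquivCM L H (N := N)) ⁻¹' Set.pi Set.univ fun w => tsupport ⇑(φ w))
      (((archPiEquivCM L H (N := N)).toHomeomorph.isCompact_preimage).2 (isCompact_univ_pi fun w => (φ w).hasCompactSupport.isCompact))
      ((isClosed_set_pi fun w _ => isClosed_tsupport _).preimage (archPiEquivCM L H (N := N)).continuous) ?_
    intro g hg
    simp only [Set.mem_preimage, Set.mem_univ_pi, not_forall] at hg
    obtain ⟨w, hw⟩ := hg
    exact Finset.prod_eq_zero (Finset.mem_univ w) (by exact image_eq_zero_of_notMem_tsupport hw)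

/-- Read-back (definitional): `archTensor L H φ g = ∏_w φ_w (g_w)`. [folklore] -/
@[simp] theorem archTensor_apply (φ : ∀ w : {w : InfinitePlace L // w.IsComplex}, C_c(↥(archLocal L N H w), ℂ))
    (g : ↥(arch (↥(maximalRealSubfield L)) L (IsCMField.complexConj L) N H)) :
    archTensor L H φ g = ∏ w, φ w (archPiEquivCM L H (N := N) g w) :=
  rfl

/-- The support of a pure tensor lies in the pull-back of the box `∏_w tsupport φ_w`. [folklore] -/
theorem tsupport_archTensor_subset (φ : ∀ w : {w : InfinitePlace L // w.IsComplex}, C_c(↥(archLocal L N H w), ℂ)) :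
    tsupport ⇑(archTensor L H φ) ⊆ ⇑(archPiEquivCM L H (N := N)) ⁻¹' Set.pi Set.univ fun w => tsupport ⇑(φ w) := by
  refine closure_minimal (fun g hg => ?_) ((isClosed_set_pi fun w _ => isClosed_tsupport _).preimage (archPiEquivCM L H (N := N)).continuous)
  simp only [Set.mem_preimage, Set.mem_univ_pi]
  intro w
  by_contra hw
  have h0 : archTensor L H φ g = 0 := by
    rw [archTensor_apply]
    exact Finset.prod_eq_zero (Finset.mem_univ w) (by exact image_eq_zero_of_notMem_tsupport hw)
  exact hg h0

/-- **THE AWAY-FROM-`w` FACTOR `⊗_{w' ≠ w} φ_{w'}`** on the tuple of the other local components (FILE 1's `fc` slot: `f = f_w ⊗ f^w`). [cite: BorelJacquet1979, §4.1] -/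
def archTensorAway (φ : ∀ w : {w : InfinitePlace L // w.IsComplex}, C_c(↥(archLocal L N H w), ℂ)) (w : {w : InfinitePlace L // w.IsComplex}) :
    (∀ w' : {w' : {w' : InfinitePlace L // w'.IsComplex} // w' ≠ w}, ↥(archLocal L N H w'.1)) → ℂ :=
  fun gc => ∏ w' : {w' : {w' : InfinitePlace L // w'.IsComplex} // w' ≠ w}, φ w'.1 (gc w')

omit [IsCMField L] in
/-- Read-back (definitional). [folklore] -/
@[simp] theorem archTensorAway_apply (φ : ∀ w : {w : InfinitePlace L // w.IsComplex}, C_c(↥(archLocal L N H w), ℂ))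
    (w : {w : InfinitePlace L // w.IsComplex}) (gc : ∀ w' : {w' : {w' : InfinitePlace L // w'.IsComplex} // w' ≠ w}, ↥(archLocal L N H w'.1)) :
    archTensorAway L H φ w gc = ∏ w' : {w' : {w' : InfinitePlace L // w'.IsComplex} // w' ≠ w}, φ w'.1 (gc w') :=
  rfl

omit [IsCMField L] in
/-- The away factor is continuous. [folklore] -/
theorem continuous_archTensorAway (φ : ∀ w : {w : InfinitePlace L // w.IsComplex}, C_c(↥(archLocal L N H w), ℂ))
    (w : {w : InfinitePlace L // w.IsComplex}) : Continuous (archTensorAway L H φ w) :=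
  continuous_finsetProd _ fun w' _ => (φ w'.1).continuous.comp (continuous_apply w')

omit [IsCMField L] in
/-- The away factor has compact support (inside the compact box `∏_{w' ≠ w} tsupport φ_{w'}`). [folklore] -/
theorem hasCompactSupport_archTensorAway (φ : ∀ w : {w : InfinitePlace L // w.IsComplex}, C_c(↥(archLocal L N H w), ℂ))
    (w : {w : InfinitePlace L // w.IsComplex}) : HasCompactSupport (archTensorAway L H φ w) := by
  refine HasCompactSupport.intro'
    (K := Set.pi Set.univ fun w' : {w' : {w' : InfinitePlace L // w'.IsComplex} // w' ≠ w} => tsupport ⇑(φ w'.1))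
    (isCompact_univ_pi fun w' => (φ w'.1).hasCompactSupport.isCompact) (isClosed_set_pi fun w' _ => isClosed_tsupport _) ?_
  intro gc hgc
  simp only [Set.mem_univ_pi, not_forall] at hgc
  obtain ⟨w', hw'⟩ := hgc
  exact Finset.prod_eq_zero (Finset.mem_univ w') (by exact image_eq_zero_of_notMem_tsupport hw')

omit [IsCMField L] in
/-- Re-indexing: a product over all complex places splits off the factor at `w`, the rest indexed by the subtype `{w' // w' ≠ w}`. [folklore] -/
theorem prod_place_eq_mul_prod_subtype_ne (w : {w : InfinitePlace L // w.IsComplex}) (F : {w : InfinitePlace L // w.IsComplex} → ℂ) :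
    ∏ w', F w' = F w * ∏ w' : {w' : {w' : InfinitePlace L // w'.IsComplex} // w' ≠ w}, F w'.1 := by
  rw [Fintype.prod_eq_mul_prod_compl w F]
  congr 1
  exact Finset.prod_subtype _ (fun w' => by rw [Finset.mem_compl, Finset.mem_singleton]) F

/-- **A PURE TENSOR FACTORS AT EVERY complex place `w`**: `(⊗ φ)(g) = φ_w(g_w) · (⊗_{w' ≠ w} φ_{w'})(g^w)` — RAW form; this statement IS the body of FILE 1's
`IsArchFactoredAtPlace H w ⇑(archTensor L H φ) ⇑(φ w) (archTensorAway L H φ w)` (dealer probe P1), the corollary in that currency being a definitional one-liner.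
[cite: Rogawski1990, §13.8 p. 218 L20–28] [cite: BorelJacquet1979, §4.1] -/
theorem archTensor_factorsAt (φ : ∀ w : {w : InfinitePlace L // w.IsComplex}, C_c(↥(archLocal L N H w), ℂ)) (w : {w : InfinitePlace L // w.IsComplex}) :
    ∀ g, archTensor L H φ g =
      φ w (archPiEquivCM L H (N := N) g w) * archTensorAway L H φ w (fun w' => archPiEquivCM L H (N := N) g w'.1) :=
  fun g => prod_place_eq_mul_prod_subtype_ne L w fun w' => φ w' (archPiEquivCM L H (N := N) g w')

/-- The same in the ★ compact-place frame of `R90S2ArchLocalCuspidalDefs`: for `τ : CptPlace L ι` (a complex place `≠ mk ι`), `⊗ φ` factors AT `τ`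
(`IsArchFactoredAt ι H τ`) with `τ`-component `φ_τ` and away factor `⊗_{w' ≠ τ} φ_{w'}`. [cite: Rogawski1990, §13.8 p. 218 L20–28] [cite: BorelJacquet1979, §4.1] -/
theorem isArchFactoredAt_archTensor (ι : L →+* ℂ) (τ : CptPlace L ι) (φ : ∀ w : {w : InfinitePlace L // w.IsComplex}, C_c(↥(archLocal L N H w), ℂ)) :
    IsArchFactoredAt ι H τ ⇑(archTensor L H φ) ⇑(φ (cptToComplex L ι τ)) (archTensorAway L H φ (cptToComplex L ι τ)) :=
  archTensor_factorsAt L H φ (cptToComplex L ι τ)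

omit [IsCMField L] in
/-- Replacing the `w`-component does not change the away-from-`w` factor. [folklore] -/
@[simp] theorem archTensorAway_update_self [DecidableEq {w : InfinitePlace L // w.IsComplex}]
    (φ : ∀ w : {w : InfinitePlace L // w.IsComplex}, C_c(↥(archLocal L N H w), ℂ)) (w : {w : InfinitePlace L // w.IsComplex})
    (ψ : C_c(↥(archLocal L N H w), ℂ)) : archTensorAway L H (Function.update φ w ψ) w = archTensorAway L H φ w := by
  funext gc
  simp only [archTensorAway_apply]
  exact Finset.prod_congr rfl fun w' _ => by rw [Function.update_of_ne w'.2]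

/-- The pure tensor with the `w`-component replaced by `ψ`: `(ψ ⊗ ⊗_{w' ≠ w} φ_{w'})(g) = ψ(g_w) · (⊗_{w' ≠ w} φ_{w'})(g^w)`. [cite: Rogawski1990, §13.8 p. 218 L20–28] -/
theorem archTensor_update_factorsAt [DecidableEq {w : InfinitePlace L // w.IsComplex}]
    (φ : ∀ w : {w : InfinitePlace L // w.IsComplex}, C_c(↥(archLocal L N H w), ℂ)) (w : {w : InfinitePlace L // w.IsComplex})
    (ψ : C_c(↥(archLocal L N H w), ℂ)) (g : ↥(arch (↥(maximalRealSubfield L)) L (IsCMField.complexConj L) N H)) :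
    archTensor L H (Function.update φ w ψ) g =
      ψ (archPiEquivCM L H (N := N) g w) * archTensorAway L H φ w (fun w' => archPiEquivCM L H (N := N) g w'.1) := by
  rw [archTensor_factorsAt L H (Function.update φ w ψ) w g, archTensorAway_update_self, Function.update_self]

/-- **ONE-PLACE DIFFERENCES STAY PURE** (print's «`f = (f_{1u} − f_{2u}) ⊗ ⊗_{w ≠ u} f_w`», proof of Prop. 13.8.3): the difference of the pure tensors with
`w`-components `ψ₁`, `ψ₂` (same away components) is the pure tensor with `w`-component `ψ₁ − ψ₂`. [cite: Rogawski1990, §13.8 p. 218 L20–28] -/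
theorem archTensor_update_sub [DecidableEq {w : InfinitePlace L // w.IsComplex}]
    (φ : ∀ w : {w : InfinitePlace L // w.IsComplex}, C_c(↥(archLocal L N H w), ℂ)) (w : {w : InfinitePlace L // w.IsComplex})
    (ψ₁ ψ₂ : C_c(↥(archLocal L N H w), ℂ)) :
    archTensor L H (Function.update φ w ψ₁) - archTensor L H (Function.update φ w ψ₂) = archTensor L H (Function.update φ w (ψ₁ - ψ₂)) := by
  ext g
  rw [CompactlySupportedContinuousMap.sub_apply, archTensor_update_factorsAt, archTensor_update_factorsAt, archTensor_update_factorsAt,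
    CompactlySupportedContinuousMap.sub_apply, sub_mul]

/-- If one local factor is `0`, the pure tensor is `0`. [folklore] -/
theorem archTensor_eq_zero_of_eq_zero (φ : ∀ w : {w : InfinitePlace L // w.IsComplex}, C_c(↥(archLocal L N H w), ℂ))
    (w : {w : InfinitePlace L // w.IsComplex}) (hw : φ w = 0) : archTensor L H φ = 0 := by
  ext g
  rw [archTensor_factorsAt L H φ w g, hw, CompactlySupportedContinuousMap.zero_apply, zero_mul, CompactlySupportedContinuousMap.zero_apply]

end GSide

/-! ## §2 Two-factor side `U(H₁)(L ⊗ ℝ) × U(H₂)(L ⊗ ℝ)` (at the `Φ₂`, `Φ₁` literals: ★ `HInf L = H_∞` by `rfl`) -/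

section HSide

variable {N₁ N₂ : ℕ} (H₁ : Matrix (Fin N₁) (Fin N₁) L) (H₂ : Matrix (Fin N₂) (Fin N₂) L)

/-- **PURE TENSOR on the two-factor archimedean group** `U(H₁)(L ⊗ ℝ) × U(H₂)(L ⊗ ℝ)` (e.g. `H_∞ = U(Φ₂) × U(Φ₁)`): `g ↦ ∏_w φ₂,w (g.1_w, g.2_w)` for local factors
`φ₂,w ∈ C_c(U(σ_w H₁)(ℂ) × U(σ_w H₂)(ℂ), ℂ)`; continuous with compact support (support inside the product of the pull-backs of the boxes of the two projections of
`tsupport φ₂,w`) — the factorizable test functions `f^H_∞ = ⊗_v f^H_v` on the endoscopic side. [cite: BorelJacquet1979, §4.1] [cite: Rogawski1990, §13.8 p. 218 L20–28] -/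
def archTensor₂ (φ₂ : ∀ w : {w : InfinitePlace L // w.IsComplex}, C_c(↥(archLocal L N₁ H₁ w) × ↥(archLocal L N₂ H₂ w), ℂ)) :
    C_c(↥(arch (↥(maximalRealSubfield L)) L (IsCMField.complexConj L) N₁ H₁) × ↥(arch (↥(maximalRealSubfield L)) L (IsCMField.complexConj L) N₂ H₂), ℂ) where
  toFun g := ∏ w, φ₂ w (archPiEquivCM L H₁ (N := N₁) g.1 w, archPiEquivCM L H₂ (N := N₂) g.2 w)
  continuous_toFun :=
    continuous_finsetProd _ fun w _ => (φ₂ w).continuous.comp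
      ((((continuous_apply w).comp (archPiEquivCM L H₁ (N := N₁)).continuous).comp continuous_fst).prodMk
        (((continuous_apply w).comp (archPiEquivCM L H₂ (N := N₂)).continuous).comp continuous_snd))
  hasCompactSupport' := by
    refine HasCompactSupport.intro'
      (K := (⇑(archPiEquivCM L H₁ (N := N₁)) ⁻¹' Set.pi Set.univ fun w => Prod.fst '' tsupport ⇑(φ₂ w)) ×ˢ
        (⇑(archPiEquivCM L H₂ (N := N₂)) ⁻¹' Set.pi Set.univ fun w => Prod.snd '' tsupport ⇑(φ₂ w)))
      ((((archPiEquivCM L H₁ (N := N₁)).toHomeomorph.isCompact_preimage).2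
          (isCompact_univ_pi fun w => (φ₂ w).hasCompactSupport.isCompact.image continuous_fst)).prod
        (((archPiEquivCM L H₂ (N := N₂)).toHomeomorph.isCompact_preimage).2
          (isCompact_univ_pi fun w => (φ₂ w).hasCompactSupport.isCompact.image continuous_snd)))
      (((isClosed_set_pi fun w _ => ((φ₂ w).hasCompactSupport.isCompact.image continuous_fst).isClosed).preimage
          (archPiEquivCM L H₁ (N := N₁)).continuous).prod
        ((isClosed_set_pi fun w _ => ((φ₂ w).hasCompactSupport.isCompact.image continuous_snd).isClosed).preimage
          (archPiEquivCM L H₂ (N := N₂)).continuous)) ?_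
    intro g hg
    simp only [Set.mem_prod, Set.mem_preimage, Set.mem_univ_pi, not_and_or, not_forall] at hg
    rcases hg with ⟨w, hw⟩ | ⟨w, hw⟩
    · exact Finset.prod_eq_zero (Finset.mem_univ w) (by exact image_eq_zero_of_notMem_tsupport fun h => hw ⟨_, h, rfl⟩)
    · exact Finset.prod_eq_zero (Finset.mem_univ w) (by exact image_eq_zero_of_notMem_tsupport fun h => hw ⟨_, h, rfl⟩)

/-- Read-back (definitional): `archTensor₂ L H₁ H₂ φ₂ g = ∏_w φ₂,w (g.1_w, g.2_w)`. [folklore] -/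
@[simp] theorem archTensor₂_apply (φ₂ : ∀ w : {w : InfinitePlace L // w.IsComplex}, C_c(↥(archLocal L N₁ H₁ w) × ↥(archLocal L N₂ H₂ w), ℂ))
    (g : ↥(arch (↥(maximalRealSubfield L)) L (IsCMField.complexConj L) N₁ H₁) × ↥(arch (↥(maximalRealSubfield L)) L (IsCMField.complexConj L) N₂ H₂)) :
    archTensor₂ L H₁ H₂ φ₂ g = ∏ w, φ₂ w (archPiEquivCM L H₁ (N := N₁) g.1 w, archPiEquivCM L H₂ (N := N₂) g.2 w) :=
  rfl

/-- **THE AWAY-FROM-`w` FACTOR, two-factor side**, on the PAIR of away-tuples (FILE 1's `IsArchFactoredAtPlace₂` `fc` slot). [cite: BorelJacquet1979, §4.1] -/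
def archTensorAway₂ (φ₂ : ∀ w : {w : InfinitePlace L // w.IsComplex}, C_c(↥(archLocal L N₁ H₁ w) × ↥(archLocal L N₂ H₂ w), ℂ))
    (w : {w : InfinitePlace L // w.IsComplex}) :
    ((∀ w' : {w' : {w' : InfinitePlace L // w'.IsComplex} // w' ≠ w}, ↥(archLocal L N₁ H₁ w'.1)) ×
      (∀ w' : {w' : {w' : InfinitePlace L // w'.IsComplex} // w' ≠ w}, ↥(archLocal L N₂ H₂ w'.1))) → ℂ :=
  fun gc => ∏ w' : {w' : {w' : InfinitePlace L // w'.IsComplex} // w' ≠ w}, φ₂ w'.1 (gc.1 w', gc.2 w')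

omit [IsCMField L] in
/-- Read-back (definitional). [folklore] -/
@[simp] theorem archTensorAway₂_apply (φ₂ : ∀ w : {w : InfinitePlace L // w.IsComplex}, C_c(↥(archLocal L N₁ H₁ w) × ↥(archLocal L N₂ H₂ w), ℂ))
    (w : {w : InfinitePlace L // w.IsComplex})
    (gc : (∀ w' : {w' : {w' : InfinitePlace L // w'.IsComplex} // w' ≠ w}, ↥(archLocal L N₁ H₁ w'.1)) ×
      (∀ w' : {w' : {w' : InfinitePlace L // w'.IsComplex} // w' ≠ w}, ↥(archLocal L N₂ H₂ w'.1))) :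
    archTensorAway₂ L H₁ H₂ φ₂ w gc = ∏ w' : {w' : {w' : InfinitePlace L // w'.IsComplex} // w' ≠ w}, φ₂ w'.1 (gc.1 w', gc.2 w') :=
  rfl

omit [IsCMField L] in
/-- The two-factor away factor is continuous. [folklore] -/
theorem continuous_archTensorAway₂ (φ₂ : ∀ w : {w : InfinitePlace L // w.IsComplex}, C_c(↥(archLocal L N₁ H₁ w) × ↥(archLocal L N₂ H₂ w), ℂ))
    (w : {w : InfinitePlace L // w.IsComplex}) : Continuous (archTensorAway₂ L H₁ H₂ φ₂ w) :=
  continuous_finsetProd _ fun w' _ => (φ₂ w'.1).continuous.comp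
    (((continuous_apply w').comp continuous_fst).prodMk ((continuous_apply w').comp continuous_snd))

/-- **A TWO-FACTOR PURE TENSOR FACTORS AT EVERY complex place `w`** — RAW form; the statement IS the body of FILE 1's `IsArchFactoredAtPlace₂`-shape predicate
(dealer probe P1-H) at `(⇑(archTensor₂ …), ⇑(φ₂ w), archTensorAway₂ … w)`. [cite: Rogawski1990, §13.8 p. 218 L20–28] [cite: BorelJacquet1979, §4.1] -/
theorem archTensor₂_factorsAt (φ₂ : ∀ w : {w : InfinitePlace L // w.IsComplex}, C_c(↥(archLocal L N₁ H₁ w) × ↥(archLocal L N₂ H₂ w), ℂ))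
    (w : {w : InfinitePlace L // w.IsComplex}) :
    ∀ g, archTensor₂ L H₁ H₂ φ₂ g =
      φ₂ w (archPiEquivCM L H₁ (N := N₁) g.1 w, archPiEquivCM L H₂ (N := N₂) g.2 w) *
        archTensorAway₂ L H₁ H₂ φ₂ w (fun w' => archPiEquivCM L H₁ (N := N₁) g.1 w'.1, fun w' => archPiEquivCM L H₂ (N := N₂) g.2 w'.1) :=
  fun g => prod_place_eq_mul_prod_subtype_ne L w fun w' => φ₂ w' (archPiEquivCM L H₁ (N := N₁) g.1 w', archPiEquivCM L H₂ (N := N₂) g.2 w')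

omit [IsCMField L] in
/-- Replacing the `w`-component does not change the two-factor away factor. [folklore] -/
@[simp] theorem archTensorAway₂_update_self [DecidableEq {w : InfinitePlace L // w.IsComplex}]
    (φ₂ : ∀ w : {w : InfinitePlace L // w.IsComplex}, C_c(↥(archLocal L N₁ H₁ w) × ↥(archLocal L N₂ H₂ w), ℂ)) (w : {w : InfinitePlace L // w.IsComplex})
    (ψ : C_c(↥(archLocal L N₁ H₁ w) × ↥(archLocal L N₂ H₂ w), ℂ)) :
    archTensorAway₂ L H₁ H₂ (Function.update φ₂ w ψ) w = archTensorAway₂ L H₁ H₂ φ₂ w := by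
  funext gc
  simp only [archTensorAway₂_apply]
  exact Finset.prod_congr rfl fun w' _ => by rw [Function.update_of_ne w'.2]

/-- The two-factor pure tensor with the `w`-component replaced by `ψ`, evaluated. [cite: Rogawski1990, §13.8 p. 218 L20–28] -/
theorem archTensor₂_update_factorsAt [DecidableEq {w : InfinitePlace L // w.IsComplex}]
    (φ₂ : ∀ w : {w : InfinitePlace L // w.IsComplex}, C_c(↥(archLocal L N₁ H₁ w) × ↥(archLocal L N₂ H₂ w), ℂ)) (w : {w : InfinitePlace L // w.IsComplex})
    (ψ : C_c(↥(archLocal L N₁ H₁ w) × ↥(archLocal L N₂ H₂ w), ℂ))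
    (g : ↥(arch (↥(maximalRealSubfield L)) L (IsCMField.complexConj L) N₁ H₁) × ↥(arch (↥(maximalRealSubfield L)) L (IsCMField.complexConj L) N₂ H₂)) :
    archTensor₂ L H₁ H₂ (Function.update φ₂ w ψ) g =
      ψ (archPiEquivCM L H₁ (N := N₁) g.1 w, archPiEquivCM L H₂ (N := N₂) g.2 w) *
        archTensorAway₂ L H₁ H₂ φ₂ w (fun w' => archPiEquivCM L H₁ (N := N₁) g.1 w'.1, fun w' => archPiEquivCM L H₂ (N := N₂) g.2 w'.1) := by
  rw [archTensor₂_factorsAt L H₁ H₂ (Function.update φ₂ w ψ) w g, archTensorAway₂_update_self, Function.update_self]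

/-- **ONE-PLACE DIFFERENCES STAY PURE, two-factor side** (print's «`f^H = (f^H_{1u} − f^H_{2u}) ⊗ ⊗_{w ≠ u} f^H_w`»). [cite: Rogawski1990, §13.8 p. 218 L20–28] -/
theorem archTensor₂_update_sub [DecidableEq {w : InfinitePlace L // w.IsComplex}]
    (φ₂ : ∀ w : {w : InfinitePlace L // w.IsComplex}, C_c(↥(archLocal L N₁ H₁ w) × ↥(archLocal L N₂ H₂ w), ℂ)) (w : {w : InfinitePlace L // w.IsComplex})
    (ψ₁ ψ₂ : C_c(↥(archLocal L N₁ H₁ w) × ↥(archLocal L N₂ H₂ w), ℂ)) :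
    archTensor₂ L H₁ H₂ (Function.update φ₂ w ψ₁) - archTensor₂ L H₁ H₂ (Function.update φ₂ w ψ₂) =
      archTensor₂ L H₁ H₂ (Function.update φ₂ w (ψ₁ - ψ₂)) := by
  ext g
  rw [CompactlySupportedContinuousMap.sub_apply, archTensor₂_update_factorsAt, archTensor₂_update_factorsAt, archTensor₂_update_factorsAt,
    CompactlySupportedContinuousMap.sub_apply, sub_mul]

end HSide

end Summit.HodgeConjecture.HodgeConjecture.R90.S2

end
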